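import Summits.BirchSwinnertonDyer.BirchSwinnertonDyer.Theorems.BiquadraticEisensteinDescentEisensteinHeartFlatCMInertBadKPrimeBiquadraticCMField
import Literature.NumberTheory.EllipticCurves.KatzPAdicLFunctionCMFieldKatzTypeBaseChangeProofs
import Literature.NumberTheory.EllipticCurves.KatzPAdicLFunctionCMFieldContinuationProofs
import HarnessLib

set_option linter.dupNamespace false -- `Summit.BirchSwinnertonDyer.BirchSwinnertonDyer.Theorems.…` (summit = sub)
set_option autoImplicit false

/-!
# Crux `EisensteinHeartFlatCMInertBadKPrime` (stmt-BirchSwinnertonDyer-21341), line `hsieh-lambda`, layer 2 (V2) —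
# INSTANTIATION of hypothesis (T): the Katz type `Σ + κ_n(1 − c)`, `κ_n = (n, n − 1)`, of `λ · χ∘N_{L/K′}` on the
# biquadratic CM field `L = K′ · K_CM`, for the branch character `λ = (ψ ∘ N_{L/K_CM}) · ‖·‖_L`

Route `BiquadraticEisensteinDescent` (cell `pub/bsd-wall`, width seat `bsd-wall-cm-bed-w1`; lead `bsd-wall-cm-bed-p1`,
skeleton `Cruxes/EisensteinHeartFlatCMInertBadKPrime/Lines/hsieh_lambda.lean` v2.1). THEOREMS ONLY (no definition, no named
fact, no `sorry`); supports stmt-BirchSwinnertonDyer-21341 as a helper; nothing about the crux's input (stub `V4`) or any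
case of BSD is asserted.

## What is discharged

The V2 stub closer `…KatzHsiehSocket.exists_isBaseChangeLine_span_C_mul_eq` (p609851) and the (L)-reduction
`Literature.….hLval_of_hasKatzType_of_heckeLFunction_eq` (p616514) carry the print-shaped binder

  `hT : ∀ χ n, 0 < n → (χ unramified) → χ.HasInfinityType (n) (−n) →
        KatzCM.HasKatzType ι Σ_p (lam * χ.compRelNorm L) 1 (fun w ↦ if w = w₁ then n else n − 1)`

(Katz type `k = 1`, `κ_n = (n, n−1)` on Hsieh's anticyclotomic range, [Hsieh2014mu] §4.1). Here it is PROVED at the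
route's frame: `K = K′` and `K₁ = K_CM` imaginary quadratic subfields of `L` (`[L : K] = 2`, `L = K·K₁`), the
`Σ`-orientation `KatzCM.InSigma ι Σ_p σ ↔ σ|_K = φ̄₀` (`φ₀` the chosen embedding of the place of `K`; this is
`…SigmaOrientation.inSigma_singleton_iff`, p614578, for `Σ_p = {𝔓′}`), `ψ` a Hecke character of `K₁` of infinity type
`(1, 0)` (the shape of `Deuring_exists_heckeCharacter_of_maximalCM`), and

  `lam := ψ.compRelNorm L * HeckeCharacter.normCharacter L`  (`= (ψ ∘ N_{L/K_CM}) · ‖·‖_L = ψ∘N · N_L⁻¹`,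
  the `η · ν` of `RankinSelbergEulerProductHeckeInducedProofs.hEP_of_polynomial_identities`).

* §1 bookkeeping of complex embeddings of `L` against an imaginary quadratic subfield `F`: `σ|_F` is the chosen
  embedding `σ_v` of the place below or its conjugate, never both; conjugating `σ` flips which.
* §2 `hasKatzType_mul_compRelNorm` — THE TYPE COMPUTATION (no hypothesis relating `K` and `K₁`): `lam · χ∘N_{L/K}` has
  Katz type `Σ + κ(1 − c)` with `κ(w) = n` at the places `w` whose chosen embedding `σ_w` restricts to `(σ_v on K ↔ σ_u on
  K₁)` ("both chosen or both conjugate") and `κ(w) = n − 1` at the others. (The factor `lam` alone has NO Katz type for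
  `Σ`: its CM type is the one induced from `K₁`, not from `K`; only the product lands in Katz's range.)
* §3 `exists_pair_iff_eq` — when `L = K·K₁` (`∃ y ∈ K₁ ∖ K` inside `L`, e.g. `√d_CM ∉ K′`,
  `…BiquadraticPrimes.sqrt_not_mem_range`) exactly ONE of the two infinite places of `L` is of the first kind
  (Galois theory of the quadratic `L/K`: `IsGalois.mem_range_algebraMap_iff_fixed`).
* §4 **`exists_hT`** — the binder `hT` in its LITERAL socket shape (`∃ w₁ ≠ w₂` exhausting the places, and the Katz type
  with `κ_n = fun w ↦ if w = w₁ then n else n − 1`), and **`hcont_of_hT`** / **`exists_hT_hcont`** — the socket's (C) binder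
  `hcont` from (T) by `KatzCM.hasEntireContinuation_of_hasKatzType_of_isPAdicCMType` (p612868).

References: [Hsieh2014mu] J. reine angew. Math. 688 (2014) §1.1, §4.1; [Katz1978] §5.1; [Weil1956] §1; [SerreAbelianLadic1968] II §2.
-/

noncomputable section

open scoped Classical Topology NumberField
open NumberField IsDedekindDomain Module NumberField.InfinitePlace

namespace Summit.BirchSwinnertonDyer.BirchSwinnertonDyer.Theorems.BiquadraticEisensteinDescentEisensteinHeartFlatCMInertBadKPrimeKatzTypeInstantiation

open Literature.NumberTheory.EllipticCurves Literature.NumberTheory.GaloisRepresentations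
open Summit.BirchSwinnertonDyer.BirchSwinnertonDyer.Theorems.BiquadraticEisensteinDescentEisensteinHeartFlatCMInertBadKPrimeBiquadraticCMField

variable {F K K₁ L : Type} [Field F] [NumberField F] [Field K] [NumberField K] [Field K₁] [NumberField K₁]
  [Field L] [NumberField L] [Algebra F L] [Algebra K L] [Algebra K₁ L]

/-! ### §1 Complex embeddings of `L` against a totally complex subfield `F` with one infinite place -/

omit [NumberField F] [NumberField L] in
/-- The place of `L` below `w` along `F → L` is the place of the restricted embedding `σ_w|_F`. [folklore] -/
theorem comap_eq_mk_comp (w : InfinitePlace L) :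
    w.comap (algebraMap F L) = InfinitePlace.mk (w.embedding.comp (algebraMap F L)) := by
  rw [← comap_mk, mk_embedding]

omit [NumberField F] [NumberField L] in
/-- `σ_w|_F` is the chosen embedding `σ_v` of the place `v = w|_F` below, or its conjugate `σ̄_v`.
[cite: NeukirchANT1999, Ch. III §1] -/
theorem comp_eq_or (w : InfinitePlace L) :
    w.embedding.comp (algebraMap F L) = (w.comap (algebraMap F L)).embedding ∨
      w.embedding.comp (algebraMap F L) = ComplexEmbedding.conjugate (w.comap (algebraMap F L)).embedding := by
  rw [comap_eq_mk_comp]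
  rcases embedding_mk_eq (w.embedding.comp (algebraMap F L)) with h | h
  · exact Or.inl h.symm
  · right
    rw [h]
    exact (ComplexEmbedding.involutive_conjugate F _).symm

omit [NumberField F] in
/-- At a place `v` of a totally complex `F`, `σ̄_v ≠ σ_v`. [cite: NeukirchANT1999, Ch. III §1] -/
theorem conjugate_embedding_ne [IsTotallyComplex F] (v : InfinitePlace F) :
    ComplexEmbedding.conjugate v.embedding ≠ v.embedding := by
  intro h
  have hr : v.IsReal := InfinitePlace.isReal_iff.mpr (ComplexEmbedding.isReal_iff.mpr h)
  exact (not_isReal_iff_isComplex.mpr (IsTotallyComplex.isComplex v)) hr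

omit [NumberField F] [NumberField L] in
/-- For `F` totally complex: `σ_w|_F ≠ σ_v` iff `σ_w|_F = σ̄_v`. [cite: NeukirchANT1999, Ch. III §1] -/
theorem comp_ne_iff [IsTotallyComplex F] (w : InfinitePlace L) :
    w.embedding.comp (algebraMap F L) ≠ (w.comap (algebraMap F L)).embedding ↔
      w.embedding.comp (algebraMap F L) = ComplexEmbedding.conjugate (w.comap (algebraMap F L)).embedding := by
  constructor
  · intro h
    rcases comp_eq_or (F := F) w with h' | h'
    · exact absurd h' h
    · exact h'
  · intro h h'
    rw [h'] at h
    exact conjugate_embedding_ne _ h.symm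

omit [NumberField F] [NumberField L] in
/-- Conjugation flips the orientation: `σ̄_w|_F = σ̄_v ↔ σ_w|_F = σ_v`. [folklore] -/
theorem conjugate_comp_eq_conjugate_iff (w : InfinitePlace L) (φ : F →+* ℂ) :
    (ComplexEmbedding.conjugate w.embedding).comp (algebraMap F L) = ComplexEmbedding.conjugate φ ↔
      w.embedding.comp (algebraMap F L) = φ := by
  rw [ComplexEmbedding.conjugate_comp]
  exact (ComplexEmbedding.involutive_conjugate F).injective.eq_iff

omit [NumberField L] in
/-- For `F` with ONE infinite place (e.g. imaginary quadratic) and a distinguished place `v` of `F`: the place below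
any `w` is `v`, so its chosen embedding is `σ_v`. [cite: NeukirchANT1999, Ch. III §1] -/
theorem comap_embedding_eq (hF : IsImaginaryQuadratic F) (w : InfinitePlace L) (v : InfinitePlace F) :
    (w.comap (algebraMap F L)).embedding = v.embedding := by
  haveI : Subsingleton (InfinitePlace F) :=
    Fintype.card_le_one_iff_subsingleton.mp hF.card_infinitePlace_eq_one.le
  rw [Subsingleton.elim (w.comap (algebraMap F L)) v]

/-! ### §2 The type computation: `lam · χ∘N_{L/K}` has Katz type `Σ + κ(1 − c)` -/

/-- **The Katz type of `λ · χ∘N_{L/K′}` (hypothesis (T) of the V2 socket, computed).** Let `K`, `K₁` be imaginary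
quadratic subfields of `L` (`L/K`, `L/K₁` Galois — quadratic in the route), `Σ_p` a `p`-adic datum whose CM type is
`Σ = {σ : σ|_K = σ̄_v}` (`hSig`; `v` the place of `K`, `σ_v` its chosen embedding — the orientation
`…SigmaOrientation.inSigma_singleton_iff` of the frame `Σ_p = {𝔓′}`), `ψ` a Hecke character of `K₁` of infinity type
`(1, 0)` and `χ` one of `K` of type `(n, −n)`, `n ≥ 1`. Then
`(ψ ∘ N_{L/K₁}) · ‖·‖_L · (χ ∘ N_{L/K})` has Katz type `Σ + κ(1 − c)` (`k = 1`) with `κ(w) = n` at the places `w` of `L`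
whose chosen embedding `σ_w` satisfies `(σ_w|_K = σ_{w|K} ↔ σ_w|_{K₁} = σ_{w|K₁})` and `κ(w) = n − 1` at the others:
at `σ ∈ Σ` the exponent is `−(1 + κ)`, at `σ̄` it is `κ` — place by place from Weil's rule for the type of `χ ∘ N`
(`HasInfinityType.compRelNorm`), the type `(−1, −1)` of `‖·‖` and additivity. [cite: Hsieh2014mu, §4.1 (characters
`λχ` of infinity type `kΣ + κ(1 − c)`, `k ≥ 1`, `κ ≥ 0`)] [cite: Weil1956, §1] [cite: SerreAbelianLadic1968, Ch. II §2.3] -/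
theorem hasKatzType_mul_compRelNorm (hK : IsImaginaryQuadratic K) (hK₁ : IsImaginaryQuadratic K₁) [IsGalois K L]
    [IsGalois K₁ L] {p : ℕ} [Fact p.Prime] {ι : PadicAlgCl p ≃+* ℂ} {Sp : Finset (HeightOneSpectrum (𝓞 L))}
    {v : InfinitePlace K}
    (hSig : ∀ σ : L →+* ℂ, KatzCM.InSigma ι Sp σ ↔ σ.comp (algebraMap K L) = ComplexEmbedding.conjugate v.embedding)
    {ψ : HeckeCharacter K₁} (hψ : ψ.HasInfinityType (fun _ ↦ 1) (fun _ ↦ 0)) {χ : HeckeCharacter K} {n : ℕ}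
    (hn : 0 < n) (hχ : χ.HasInfinityType (fun _ ↦ (n : ℤ)) (fun _ ↦ -(n : ℤ))) :
    KatzCM.HasKatzType ι Sp (ψ.compRelNorm L * HeckeCharacter.normCharacter L * χ.compRelNorm L) 1
      (fun w ↦ if (w.embedding.comp (algebraMap K L) = (w.comap (algebraMap K L)).embedding ↔
          w.embedding.comp (algebraMap K₁ L) = (w.comap (algebraMap K₁ L)).embedding) then n else n - 1) := by
  haveI := hK.2
  haveI := hK₁.2
  haveI : IsTotallyComplex L := isTotallyComplex_of_tower (K := K)
  have h1 := hψ.compRelNorm L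
  have h2 := hχ.compRelNorm L
  have hν := HeckeCharacter.hasInfinityType_normCharacter' (K := L)
  have h := (h1.mul' hν).mul' h2
  unfold KatzCM.HasKatzType
  have hcast : ((n - 1 : ℕ) : ℤ) = (n : ℤ) - 1 := by omega
  -- compare the two types place by place (`σ_w ∈ Σ ↔ σ_w|_K ≠ σ_v`, `σ̄_w ∈ Σ ↔ σ_w|_K = σ_v`)
  convert h using 2
  all_goals
    funext w
    have hwr : ¬ w.IsReal := not_isReal_iff_isComplex.mpr (IsTotallyComplex.isComplex w)
    have hφ₀ : (w.comap (algebraMap K L)).embedding = v.embedding := comap_embedding_eq hK w v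
    have hin : KatzCM.InSigma ι Sp w.embedding ↔
        ¬ w.embedding.comp (algebraMap K L) = (w.comap (algebraMap K L)).embedding := by
      rw [hSig, ← hφ₀]
      exact (comp_ne_iff (F := K) w).symm
    have hin' : KatzCM.InSigma ι Sp (ComplexEmbedding.conjugate w.embedding) ↔
        w.embedding.comp (algebraMap K L) = (w.comap (algebraMap K L)).embedding := by
      rw [hSig, conjugate_comp_eq_conjugate_iff, hφ₀]
    simp only [HeckeCharacter.typeOfExponent, KatzCM.katzExponent, InfinitePlace.mk_embedding,
      InfinitePlace.mk_conjugate_eq, if_neg hwr, Pi.add_apply, Nat.cast_one]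
    by_cases hA : w.embedding.comp (algebraMap K L) = (w.comap (algebraMap K L)).embedding <;>
      by_cases hA₁ : w.embedding.comp (algebraMap K₁ L) = (w.comap (algebraMap K₁ L)).embedding <;>
      simp only [hA, hA₁, hin, hin', iff_true, iff_false, not_true_eq_false, not_false_eq_true, if_true,
        if_false, hcast] <;>
      ring

/-! ### §3 Which place carries `κ = n`: exactly one of the two, when `L = K · K₁` -/

omit [NumberField F] in
/-- For `F` totally complex and `φ : F → ℂ`: `φ̄` is the chosen embedding of the place of `φ` iff `φ` is not.
[cite: NeukirchANT1999, Ch. III §1] -/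
theorem conjugate_eq_embedding_mk_iff [IsTotallyComplex F] (φ : F →+* ℂ) :
    ComplexEmbedding.conjugate φ = (InfinitePlace.mk φ).embedding ↔ ¬ φ = (InfinitePlace.mk φ).embedding := by
  have hne := conjugate_embedding_ne (InfinitePlace.mk φ)
  rcases embedding_mk_eq φ with h | h
  · rw [h] at hne ⊢
    constructor
    · intro h1 _
      exact hne h1
    · intro h1
      exact absurd rfl h1
  · rw [h] at hne ⊢
    rw [ComplexEmbedding.involutive_conjugate F φ] at hne
    constructor
    · intro _ h2
      exact hne h2
    · intro _
      rfl

omit [NumberField F] [NumberField L] in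
/-- Conjugating an embedding `σ` of `L` flips whether `σ|_F` is the chosen embedding of its place (`F` totally
complex). [cite: NeukirchANT1999, Ch. III §1] -/
theorem conjugate_comp_eq_embedding_mk_iff [IsTotallyComplex F] (σ : L →+* ℂ) :
    (ComplexEmbedding.conjugate σ).comp (algebraMap F L) =
        (InfinitePlace.mk ((ComplexEmbedding.conjugate σ).comp (algebraMap F L))).embedding ↔
      ¬ σ.comp (algebraMap F L) = (InfinitePlace.mk (σ.comp (algebraMap F L))).embedding := by
  rw [ComplexEmbedding.conjugate_comp, mk_conjugate_eq]
  exact conjugate_eq_embedding_mk_iff _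

omit [NumberField K] [NumberField K₁] [NumberField L] in
/-- The orientation predicate of §2 at the place of an embedding `σ` of `L` ("`σ_w|_K` chosen ↔ `σ_w|_{K₁}` chosen",
`w` the place of `σ`) is that of `σ` itself: it is invariant under `σ ↦ σ̄` (both sides flip; `K`, `K₁` totally
complex). [cite: NeukirchANT1999, Ch. III §1] -/
theorem iff_at_mk [IsTotallyComplex K] [IsTotallyComplex K₁] (σ : L →+* ℂ) :
    ((InfinitePlace.mk σ).embedding.comp (algebraMap K L) =
          ((InfinitePlace.mk σ).comap (algebraMap K L)).embedding ↔
        (InfinitePlace.mk σ).embedding.comp (algebraMap K₁ L) =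
          ((InfinitePlace.mk σ).comap (algebraMap K₁ L)).embedding) ↔
      (σ.comp (algebraMap K L) = (InfinitePlace.mk (σ.comp (algebraMap K L))).embedding ↔
        σ.comp (algebraMap K₁ L) = (InfinitePlace.mk (σ.comp (algebraMap K₁ L))).embedding) := by
  rw [comap_eq_mk_comp, comap_eq_mk_comp]
  rcases embedding_mk_eq σ with h | h
  · rw [h]
  · rw [h, conjugate_comp_eq_embedding_mk_iff (F := K) σ, conjugate_comp_eq_embedding_mk_iff (F := K₁) σ]
    exact not_iff_not

omit [NumberField L] in
/-- Every embedding of an imaginary quadratic `F` is the chosen embedding `σ_u` of its (unique) place or `σ̄_u`,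
and these differ. [cite: NeukirchANT1999, Ch. III §1] -/
theorem eq_embedding_or (hF : IsImaginaryQuadratic F) (u : InfinitePlace F) (φ : F →+* ℂ) :
    (φ = u.embedding ∨ φ = ComplexEmbedding.conjugate u.embedding) ∧
      ComplexEmbedding.conjugate u.embedding ≠ u.embedding := by
  haveI := hF.2
  haveI : Subsingleton (InfinitePlace F) :=
    Fintype.card_le_one_iff_subsingleton.mp hF.card_infinitePlace_eq_one.le
  refine ⟨?_, conjugate_embedding_ne u⟩
  have hu : InfinitePlace.mk φ = u := Subsingleton.elim _ _
  rcases embedding_mk_eq φ with h | h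
  · exact Or.inl (by rw [← h, hu])
  · right
    rw [← hu, h]
    exact (ComplexEmbedding.involutive_conjugate F _).symm

/-- Propositional bookkeeping: `(A ↔ ¬B) ↔ ¬(A ↔ B)`. [folklore] -/
theorem iff_not_iff_not_iff {A B : Prop} : (A ↔ ¬ B) ↔ ¬ (A ↔ B) := by
  tauto

/-- **Exactly one of the two infinite places of `L = K · K₁` has "`σ_w|_K` chosen ↔ `σ_w|_{K₁}` chosen".** For `K`, `K₁`
imaginary quadratic inside `L` with `L/K` Galois of degree `2` and `K₁ ⊄ K` inside `L` (`hgen`; in the route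
`√d_CM ∉ K′`, `…BiquadraticPrimes.sqrt_not_mem_range`): a `K`-automorphism `g` of `L` moving `K₁` exists
(`IsGalois.mem_range_algebraMap_iff_fixed`), so `σ` and `σ ∘ g` agree on `K` and differ on `K₁` — their places have
opposite orientation; `L` has exactly two places (`…BiquadraticCMField.exists_infinitePlace_pair`). This turns the
`κ` of §2 into the socket's `fun w ↦ if w = w₁ then n else n − 1`. [cite: NeukirchANT1999, Ch. III §1]
[cite: Hsieh2014mu, §1.1 (the CM type `Σ` of the frame and its complement)] -/
theorem exists_pair_iff_eq (hK : IsImaginaryQuadratic K) (hK₁ : IsImaginaryQuadratic K₁) [IsGalois K L]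
    (h2 : finrank K L = 2) (hgen : ∃ y : K₁, algebraMap K₁ L y ∉ Set.range (algebraMap K L)) :
    ∃ w₁ w₂ : InfinitePlace L, w₁ ≠ w₂ ∧ (∀ w : InfinitePlace L, w = w₁ ∨ w = w₂) ∧
      ∀ w : InfinitePlace L,
        ((w.embedding.comp (algebraMap K L) = (w.comap (algebraMap K L)).embedding ↔
            w.embedding.comp (algebraMap K₁ L) = (w.comap (algebraMap K₁ L)).embedding) ↔ w = w₁) := by
  haveI := hK.2
  haveI := hK₁.2
  haveI : Module.Finite K L := Module.Finite.of_restrictScalars_finite ℚ K L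
  obtain ⟨y, hy⟩ := hgen
  obtain ⟨g, hg⟩ : ∃ g : L ≃ₐ[K] L, g (algebraMap K₁ L y) ≠ algebraMap K₁ L y := by
    by_contra h
    exact hy ((IsGalois.mem_range_algebraMap_iff_fixed _).mpr fun g ↦ not_not.mp (not_exists.mp h g))
  obtain ⟨w₀⟩ : Nonempty (InfinitePlace L) := inferInstance
  obtain ⟨u⟩ : Nonempty (InfinitePlace K₁) := inferInstance
  -- the twisted embedding `e₁ = σ_{w₀} ∘ g`: the same restriction to `K`, the other restriction to `K₁`
  set e₁ : L →+* ℂ := w₀.embedding.comp (g : L →+* L) with he₁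
  have hKeq : e₁.comp (algebraMap K L) = w₀.embedding.comp (algebraMap K L) := RingHom.ext fun x ↦ by simp [he₁]
  have hmk₁ : ∀ φ : K₁ →+* ℂ, (InfinitePlace.mk φ).embedding = u.embedding := fun φ ↦ by
    haveI : Subsingleton (InfinitePlace K₁) :=
      Fintype.card_le_one_iff_subsingleton.mp hK₁.card_infinitePlace_eq_one.le
    rw [Subsingleton.elim (InfinitePlace.mk φ) u]
  have hflip : (e₁.comp (algebraMap K₁ L) = (InfinitePlace.mk (e₁.comp (algebraMap K₁ L))).embedding) ↔
      ¬ (w₀.embedding.comp (algebraMap K₁ L) =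
        (InfinitePlace.mk (w₀.embedding.comp (algebraMap K₁ L))).embedding) := by
    rw [hmk₁, hmk₁]
    obtain ⟨h1, -⟩ := eq_embedding_or hK₁ u (e₁.comp (algebraMap K₁ L))
    obtain ⟨h0, -⟩ := eq_embedding_or hK₁ u (w₀.embedding.comp (algebraMap K₁ L))
    have hK₁ne : e₁.comp (algebraMap K₁ L) ≠ w₀.embedding.comp (algebraMap K₁ L) := by
      intro h
      have h' := RingHom.congr_fun h y
      simp only [he₁, RingHom.coe_comp, Function.comp_apply, RingHom.coe_coe] at h'
      exact hg (w₀.embedding.injective h')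
    constructor
    · exact fun ha hb ↦ hK₁ne (ha.trans hb.symm)
    · intro hb
      rcases h1 with h1 | h1
      · exact h1
      rcases h0 with h0 | h0
      · exact absurd h0 hb
      · exact absurd (h1.trans h0.symm) hK₁ne
  -- so the orientation predicates at the place `w₀` and at the place `wb` of `e₁` are opposite
  have hP0 := iff_at_mk (K := K) (K₁ := K₁) w₀.embedding
  rw [mk_embedding] at hP0
  have hPb := iff_at_mk (K := K) (K₁ := K₁) e₁
  rw [hKeq, hflip] at hPb
  rw [iff_not_iff_not_iff, ← hP0] at hPb
  set wb : InfinitePlace L := InfinitePlace.mk e₁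
  -- now `hPb : P(wb) ↔ ¬ P(w₀)` for the orientation predicate `P`
  have hne0b : w₀ ≠ wb := by
    intro h
    rw [← h] at hPb
    exact iff_not_self hPb
  -- `L` has exactly two infinite places, hence exactly `w₀` and `wb`
  obtain ⟨u₁, u₂, -, huniv⟩ := exists_infinitePlace_pair hK h2
  have cover : ∀ w : InfinitePlace L, w = w₀ ∨ w = wb := by
    intro w
    rcases huniv w₀ with h0 | h0 <;> rcases huniv wb with hb | hb <;> rw [h0, hb] at hne0b ⊢ <;>
      first | exact absurd rfl hne0b | exact huniv w | exact (huniv w).symm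
  by_cases hP : (w₀.embedding.comp (algebraMap K L) = (w₀.comap (algebraMap K L)).embedding ↔
      w₀.embedding.comp (algebraMap K₁ L) = (w₀.comap (algebraMap K₁ L)).embedding)
  · refine ⟨w₀, wb, hne0b, cover, fun w ↦ ?_⟩
    rcases cover w with rfl | rfl
    · exact iff_of_true hP rfl
    · exact iff_of_false (fun hb ↦ hPb.mp hb hP) (Ne.symm hne0b)
  · refine ⟨wb, w₀, Ne.symm hne0b, fun w ↦ (cover w).symm, fun w ↦ ?_⟩
    rcases cover w with rfl | rfl
    · exact iff_of_false hP hne0b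
    · exact iff_of_true (hPb.mpr hP) rfl

/-! ### §4 The socket's binders (T) and (C) in their literal shapes -/

/-- **Hypothesis (T) of the V2 socket `…KatzHsiehSocket.exists_isBaseChangeLine_span_C_mul_eq` (and of
`hLval_of_hasKatzType_of_heckeLFunction_eq`) DISCHARGED at the biquadratic frame.** For `K = K′` and `K₁ = K_CM`
imaginary quadratic inside `L` (`L/K`, `L/K₁` Galois, `[L : K] = 2`, `K₁ ⊄ K`), the orientation
`KatzCM.InSigma ι Σ_p σ ↔ σ|_K = σ̄_v` (`…SigmaOrientation.inSigma_singleton_iff` at `Σ_p = {𝔓′}`), and `ψ` a Hecke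
character of `K₁` of infinity type `(1, 0)` (Deuring): THERE ARE `w₁ ≠ w₂` exhausting the infinite places of `L` such
that for every `χ` of `K` of type `(n, −n)`, `n ≥ 1` (the unramifiedness binder of the socket is carried, unused),
`(ψ.compRelNorm L * ‖·‖_L) * χ.compRelNorm L` has Katz type `k = 1`, `κ_n = fun w ↦ if w = w₁ then n else n − 1` —
literally the socket's `hT` for `lam := ψ.compRelNorm L * HeckeCharacter.normCharacter L`.
[cite: Hsieh2014mu, §4.1 (the interpolation range `kΣ + κ(1 − c)`, `k ≥ 1`, `κ ≥ 0`)] [cite: Weil1956, §1] -/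
theorem exists_hT (hK : IsImaginaryQuadratic K) (hK₁ : IsImaginaryQuadratic K₁) [IsGalois K L] [IsGalois K₁ L]
    (h2 : finrank K L = 2) (hgen : ∃ y : K₁, algebraMap K₁ L y ∉ Set.range (algebraMap K L)) {p : ℕ} [Fact p.Prime]
    {ι : PadicAlgCl p ≃+* ℂ} {Sp : Finset (HeightOneSpectrum (𝓞 L))} {v : InfinitePlace K}
    (hSig : ∀ σ : L →+* ℂ, KatzCM.InSigma ι Sp σ ↔ σ.comp (algebraMap K L) = ComplexEmbedding.conjugate v.embedding)
    {ψ : HeckeCharacter K₁} (hψ : ψ.HasInfinityType (fun _ ↦ 1) (fun _ ↦ 0)) :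
    ∃ w₁ w₂ : InfinitePlace L, w₁ ≠ w₂ ∧ (∀ w : InfinitePlace L, w = w₁ ∨ w = w₂) ∧
      ∀ (χ : HeckeCharacter K) (n : ℕ), 0 < n → (∀ v : HeightOneSpectrum (𝓞 K), χ.IsUnramifiedAt v) →
        χ.HasInfinityType (fun _ ↦ (n : ℤ)) (fun _ ↦ -(n : ℤ)) →
        KatzCM.HasKatzType ι Sp (ψ.compRelNorm L * HeckeCharacter.normCharacter L * χ.compRelNorm L) 1
          (fun w ↦ if w = w₁ then n else n - 1) := by
  obtain ⟨w₁, w₂, hne, huniv, hiff⟩ := exists_pair_iff_eq hK hK₁ h2 hgen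
  refine ⟨w₁, w₂, hne, huniv, fun χ n hn _ hχ ↦ ?_⟩
  have h := hasKatzType_mul_compRelNorm (L := L) hK hK₁ hSig hψ hn hχ
  have hκ : (fun w : InfinitePlace L ↦
      if (w.embedding.comp (algebraMap K L) = (w.comap (algebraMap K L)).embedding ↔
          w.embedding.comp (algebraMap K₁ L) = (w.comap (algebraMap K₁ L)).embedding) then n else n - 1) =
      fun w ↦ if w = w₁ then n else n - 1 := by
    funext w
    by_cases hw : w = w₁
    · rw [if_pos hw, if_pos ((hiff w).mpr hw)]
    · rw [if_neg hw, if_neg (mt (hiff w).mp hw)]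
  rw [hκ] at h
  exact h

/-- **Hypothesis (C) of the V2 socket from (T)**, in the socket's literal shape: on a CM field `L` with a `p`-adic CM
type `Σ_p`, every `lam · χ∘N_{L/K}` of Katz type `k = 1` has an entire Hecke `L`-function
(`KatzCM.hasEntireContinuation_of_hasKatzType_of_isPAdicCMType`: weight `−1`, not a norm twist, Tate). Generic in
`lam` and `κ_n`. [cite: Hsieh2014mu, §4.1] [cite: TateThesis1967, Thm. 4.4.1] -/
theorem hcont_of_hT [IsCMField L] [IsGalois K L] {p : ℕ} [Fact p.Prime] {ι : PadicAlgCl p ≃+* ℂ}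
    {Sp : Finset (HeightOneSpectrum (𝓞 L))} (hSp : KatzCM.IsPAdicCMType p Sp) {lam : HeckeCharacter L}
    {κ_ : ℕ → InfinitePlace L → ℕ}
    (hT : ∀ (χ : HeckeCharacter K) (n : ℕ), 0 < n → (∀ v : HeightOneSpectrum (𝓞 K), χ.IsUnramifiedAt v) →
      χ.HasInfinityType (fun _ ↦ (n : ℤ)) (fun _ ↦ -(n : ℤ)) →
      KatzCM.HasKatzType ι Sp (lam * χ.compRelNorm L) 1 (κ_ n)) :
    ∀ (χ : HeckeCharacter K) (n : ℕ), 0 < n → (∀ v : HeightOneSpectrum (𝓞 K), χ.IsUnramifiedAt v) →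
      χ.HasInfinityType (fun _ ↦ (n : ℤ)) (fun _ ↦ -(n : ℤ)) →
      LFunction.HasEntireContinuation (heckeLFunction (lam * χ.compRelNorm L)) :=
  fun χ n hn hu hχ ↦ KatzCM.hasEntireContinuation_of_hasKatzType_of_isPAdicCMType hSp (hT χ n hn hu hχ) le_rfl

/-- **(T) and (C) of the V2 socket together, at the frame**: the places `w₁ ≠ w₂`, the Katz type of
`(ψ.compRelNorm L * ‖·‖_L) * χ.compRelNorm L` with `κ_n = (n, n − 1)`, and the entire continuation of its Hecke
`L`-function, for every `χ` of type `(n, −n)`, `n ≥ 1` (`L` a CM field, `Σ_p` a `p`-adic CM type — at the route's frame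
`…BiquadraticCMField.isCMField`, `…BiquadraticCMType.isPAdicCMType_singleton`). [cite: Hsieh2014mu, §1.1, §4.1] -/
theorem exists_hT_hcont (hK : IsImaginaryQuadratic K) (hK₁ : IsImaginaryQuadratic K₁) [IsCMField L] [IsGalois K L]
    [IsGalois K₁ L] (h2 : finrank K L = 2) (hgen : ∃ y : K₁, algebraMap K₁ L y ∉ Set.range (algebraMap K L))
    {p : ℕ} [Fact p.Prime] {ι : PadicAlgCl p ≃+* ℂ} {Sp : Finset (HeightOneSpectrum (𝓞 L))}
    (hSp : KatzCM.IsPAdicCMType p Sp) {v : InfinitePlace K}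
    (hSig : ∀ σ : L →+* ℂ, KatzCM.InSigma ι Sp σ ↔ σ.comp (algebraMap K L) = ComplexEmbedding.conjugate v.embedding)
    {ψ : HeckeCharacter K₁} (hψ : ψ.HasInfinityType (fun _ ↦ 1) (fun _ ↦ 0)) :
    ∃ w₁ w₂ : InfinitePlace L, w₁ ≠ w₂ ∧ (∀ w : InfinitePlace L, w = w₁ ∨ w = w₂) ∧
      (∀ (χ : HeckeCharacter K) (n : ℕ), 0 < n → (∀ v : HeightOneSpectrum (𝓞 K), χ.IsUnramifiedAt v) →
        χ.HasInfinityType (fun _ ↦ (n : ℤ)) (fun _ ↦ -(n : ℤ)) →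
        KatzCM.HasKatzType ι Sp (ψ.compRelNorm L * HeckeCharacter.normCharacter L * χ.compRelNorm L) 1
          (fun w ↦ if w = w₁ then n else n - 1)) ∧
      ∀ (χ : HeckeCharacter K) (n : ℕ), 0 < n → (∀ v : HeightOneSpectrum (𝓞 K), χ.IsUnramifiedAt v) →
        χ.HasInfinityType (fun _ ↦ (n : ℤ)) (fun _ ↦ -(n : ℤ)) →
        LFunction.HasEntireContinuation
          (heckeLFunction (ψ.compRelNorm L * HeckeCharacter.normCharacter L * χ.compRelNorm L)) := by
  obtain ⟨w₁, w₂, hne, huniv, hT⟩ := exists_hT hK hK₁ h2 hgen hSig hψ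
  exact ⟨w₁, w₂, hne, huniv, hT, hcont_of_hT hSp hT⟩

end Summit.BirchSwinnertonDyer.BirchSwinnertonDyer.Theorems.BiquadraticEisensteinDescentEisensteinHeartFlatCMInertBadKPrimeKatzTypeInstantiation

end
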